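import Summits.NavierStokesRegularity.FluidComputer.BlockPairStall

/-!
# Block design — fences for the damped pair field (energy floor, clock, decay)
(bp3 gen 36, ASSEMBLY §2g.9(s); the kit for the exact-orbit hand-off theorem `BlockPairHandoff`)

HONEST FRAMING: low prior, high value-of-information experiment on Tao's machine paradigm; NOT a
claim that NS blows up. Design level only: elementary real analysis of the planar polynomial field
`pairVF Λ₁ Λ₂ η k 0` of `BlockPairStall` (its backscatter-free member `k' = 0`, the field the
residue pins the design to, `BlockPairSupport`). Nothing here is a statement about Navier–Stokes,
and nothing here is a reach CERTIFICATE: pseudo-orbits, tubes and working regions are not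
treated — only exact orbits `z` of the field on `[0, 1]` (one tick = rescaled time `1`) from a
clean input `z 0 = (A₀, 0)`, `a := (z ·).1` the input mode, `b := (z ·).2` the output mode.

WHAT IS PROVED (all by comparison fences, `image_le_of_deriv_right_(le|lt)_deriv_boundary`).
* `pair_orbit_basic`: `0 < a ≤ A₀`, `0 ≤ b`, `a² + η b² ≤ A₀²` (from `BlockPairStall`).
* ENERGY FLOOR `pair_energy_ge`: with damping `Λ₁, Λ₂ ≤ 1/20`, `a² + η b² ≥ A₀² (1 - t/8)`
  (the dissipation `2 (Λ₁ a² + η Λ₂ b²)` is at most `A₀²/10` per tick).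
* CLOCK `pair_snd_reaches_half`: for `1/2 ≤ η ≤ 3/4`, `k ≥ 6`, `A₀ ≥ 29/20` (so that
  `x := η k A₀ ≥ 87/20`) the output reaches `A₀/2` by time `1/x` — else on `[0, 1/x]` the
  fences `a ≥ A₀ - m t` (`m = A₀/20 + x A₀/2`) and `b ≥ (k A₀² - A₀/40) t - k A₀ m t²` give
  `b(1/x) > A₀/2`.
* OUTPUT STAYS UP `pair_snd_ge_after`: once `b ≥ A₀/2`, `b ≥ (A₀/2) e^{-(t - t_A)/10} ≥ 0.45 A₀`
  (strict exponential fence at rate `1/10 > Λ₂`; the drive `k a²` is nonnegative).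
* INPUT DECAYS `pair_fst_decay`: `a(t) ≤ a(t₀) e^{-ρ (t - t₀)}` for any rate `ρ < η k b` on
  `[t₀, 1]`.
The constants are generous, not optimised. [folklore]
-/

open Set Filter Topology

namespace Summit.NavierStokesRegularity.FluidComputer

open Literature.Analysis.FluidPDE Literature.Analysis.FluidPDE.FluidComputer

namespace BlockDesign

section Transit

variable {Λ₁ Λ₂ η k : ℝ} {z : ℝ → ℝ × ℝ}

/-- First component of the backscatter-free pair field. [folklore] -/
theorem pairVF_zero_fst (Λ₁ Λ₂ η k : ℝ) (p : ℝ × ℝ) :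
    (pairVF Λ₁ Λ₂ η k 0 p).1 = -(Λ₁ * p.1) - η * k * p.1 * p.2 := by
  simp only [pairVF]; ring

/-- Second component of the backscatter-free pair field. [folklore] -/
theorem pairVF_zero_snd (Λ₁ Λ₂ η k : ℝ) (p : ℝ × ℝ) :
    (pairVF Λ₁ Λ₂ η k 0 p).2 = -(Λ₂ * p.2) + k * p.1 ^ 2 := by
  simp only [pairVF]; ring

/-- Standing facts along an exact orbit from a clean input `(A₀, 0)`, `A₀ > 0`, on `[0, 1]`
(`Λ₁, Λ₂, η ≥ 0`, `k > 0`): `0 < a ≤ A₀`, `0 ≤ b`, `a² + η b² ≤ A₀²`. [folklore] -/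
theorem pair_orbit_basic (hΛ₁ : 0 ≤ Λ₁) (hΛ₂ : 0 ≤ Λ₂) (hη : 0 ≤ η) (hk : 0 < k)
    (hcont : ContinuousOn z (Icc 0 1))
    (hderiv : ∀ t ∈ Ico (0:ℝ) 1, HasDerivWithinAt z (pairVF Λ₁ Λ₂ η k 0 (z t)) (Ici t) t)
    (h0 : 0 < (z 0).1) (h0' : (z 0).2 = 0) :
    ∀ t ∈ Icc (0:ℝ) 1, 0 < (z t).1 ∧ (z t).1 ≤ (z 0).1 ∧ 0 ≤ (z t).2 ∧
      (z t).1 ^ 2 + η * (z t).2 ^ 2 ≤ (z 0).1 ^ 2 := by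
  intro t ht
  have ha := pair_fst_pos hη hk.le le_rfl hcont hderiv h0 t ht
  have hb := pair_snd_nonneg hη hk le_rfl hcont hderiv h0 h0' t ht
  have hE := pair_energy_le hΛ₁ hΛ₂ hη hcont hderiv t ht
  simp only [pairEnergy, h0'] at hE
  refine ⟨ha, ?_, hb, by nlinarith [hE]⟩
  nlinarith [mul_nonneg hη (sq_nonneg (z t).2), hE]

/-- **ENERGY FLOOR.** With damping `Λ₁, Λ₂ ≤ 1/20`: `a(t)² + η b(t)² ≥ A₀² (1 - t/8)` on `[0, 1]`
(the dissipation `2(Λ₁ a² + η Λ₂ b²)` is at most `A₀²/10 ≤ A₀²/8`). [folklore] -/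
theorem pair_energy_ge (hΛ₁ : 0 ≤ Λ₁) (hΛ₂ : 0 ≤ Λ₂) (hΛ₁' : Λ₁ ≤ 1 / 20) (hΛ₂' : Λ₂ ≤ 1 / 20)
    (hη : 0 ≤ η) (hk : 0 < k) (hcont : ContinuousOn z (Icc 0 1))
    (hderiv : ∀ t ∈ Ico (0:ℝ) 1, HasDerivWithinAt z (pairVF Λ₁ Λ₂ η k 0 (z t)) (Ici t) t)
    (h0 : 0 < (z 0).1) (h0' : (z 0).2 = 0) :
    ∀ t ∈ Icc (0:ℝ) 1, (z 0).1 ^ 2 * (1 - t / 8) ≤ (z t).1 ^ 2 + η * (z t).2 ^ 2 := by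
  have hf := (continuousOn_pairEnergy_comp hcont η).neg
  have hf' : ∀ x ∈ Ico (0:ℝ) 1, HasDerivWithinAt (fun x => -pairEnergy η (z x))
      (-(2 * ((z x).1 * (pairVF Λ₁ Λ₂ η k 0 (z x)).1 +
        η * (z x).2 * (pairVF Λ₁ Λ₂ η k 0 (z x)).2))) (Ici x) x :=
    fun x hx => (hasDerivWithinAt_pairEnergy_comp (hderiv x hx) η).neg
  have hB : ∀ x, HasDerivAt (fun t : ℝ => (z 0).1 ^ 2 / 8 * t + -((z 0).1 ^ 2))
      ((z 0).1 ^ 2 / 8) x := fun x => (hasDerivAt_const_mul _).add_const _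
  intro t ht
  have key := image_le_of_deriv_right_le_deriv_boundary hf hf'
    (B := fun t => (z 0).1 ^ 2 / 8 * t + -((z 0).1 ^ 2)) (B' := fun _ => (z 0).1 ^ 2 / 8)
    (by simp [pairEnergy, h0']) (fun x _ => (hB x).continuousAt.continuousWithinAt)
    (fun x _ => (hB x).hasDerivWithinAt)
    (fun x hx => by
      have hb := pair_orbit_basic hΛ₁ hΛ₂ hη hk hcont hderiv h0 h0' x (Ico_subset_Icc_self hx)
      show -(2 * ((z x).1 * (pairVF Λ₁ Λ₂ η k 0 (z x)).1 +
          η * (z x).2 * (pairVF Λ₁ Λ₂ η k 0 (z x)).2)) ≤ (z 0).1 ^ 2 / 8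
      rw [pairVF_energy]
      have h1 := mul_le_mul_of_nonneg_right hΛ₁' (sq_nonneg (z x).1)
      have h2 := mul_le_mul_of_nonneg_right hΛ₂' (mul_nonneg hη (sq_nonneg (z x).2))
      nlinarith [h1, h2, hb.2.2.2])
    ht
  have key' : -pairEnergy η (z t) ≤ (z 0).1 ^ 2 / 8 * t + -((z 0).1 ^ 2) := key
  unfold pairEnergy at key'
  linarith

set_option maxHeartbeats 400000 in
/-- **CLOCK.** `1/2 ≤ η ≤ 3/4`, `k ≥ 6`, `Λ₁, Λ₂ ∈ [0, 1/20]`, clean input `A₀ ≥ 29/20`: some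
`t_A ≤ 1/x`, `x = η k A₀`, has `b(t_A) ≥ A₀/2`. Otherwise on `[0, 1/x]` the fences
`a ≥ A₀ - m t` (`m = A₀/20 + x A₀/2`) and `b ≥ (k A₀² - A₀/40) t - k A₀ m t²` would give
`b(1/x) > 0.64 A₀`. [folklore] -/
theorem pair_snd_reaches_half (hη : 1 / 2 ≤ η) (hη2 : η ≤ 3 / 4) (hk : 6 ≤ k)
    (hΛ₁ : 0 ≤ Λ₁) (hΛ₂ : 0 ≤ Λ₂) (hΛ₁' : Λ₁ ≤ 1 / 20) (hΛ₂' : Λ₂ ≤ 1 / 20)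
    (hcont : ContinuousOn z (Icc 0 1))
    (hderiv : ∀ t ∈ Ico (0:ℝ) 1, HasDerivWithinAt z (pairVF Λ₁ Λ₂ η k 0 (z t)) (Ici t) t)
    {A₀ : ℝ} (hA₀ : 29 / 20 ≤ A₀) (hz0 : z 0 = (A₀, 0)) :
    ∃ tA ∈ Icc (0:ℝ) (1 / (η * k * A₀)), A₀ / 2 ≤ (z tA).2 := by
  have hη0 : 0 < η := by linarith
  have hk0 : 0 < k := by linarith
  have hA : 0 < A₀ := by linarith
  have h0 : 0 < (z 0).1 := by rw [hz0]; exact hA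
  have h0' : (z 0).2 = 0 := by rw [hz0]
  have hz01 : (z 0).1 = A₀ := by rw [hz0]
  have hx : 87 / 20 ≤ η * k * A₀ := by
    have h1 : (1 / 2 : ℝ) * 6 ≤ η * k := mul_le_mul hη hk (by norm_num) hη0.le
    have h2 := mul_le_mul h1 hA₀ (by norm_num) (mul_nonneg hη0.le hk0.le)
    linarith
  set τ : ℝ := 1 / (η * k * A₀) with hτ
  have hxτ : η * k * A₀ * τ = 1 := by rw [hτ]; field_simp
  have hτpos : 0 < τ := by positivity
  have hτ4 : τ ≤ 1 / 4 := by rw [hτ, div_le_iff₀ (by positivity)]; linarith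
  have hτ1 : τ ≤ 1 := by linarith
  by_contra H
  push Not at H
  have basic := pair_orbit_basic hΛ₁ hΛ₂ hη0.le hk0 hcont hderiv h0 h0'
  have hsub : Icc (0:ℝ) τ ⊆ Icc 0 1 := Icc_subset_Icc_right hτ1
  have hcont' : ContinuousOn z (Icc 0 τ) := hcont.mono hsub
  have hderiv' : ∀ t ∈ Ico (0:ℝ) τ, HasDerivWithinAt z (pairVF Λ₁ Λ₂ η k 0 (z t)) (Ici t) t :=
    fun t ht => hderiv t ⟨ht.1, ht.2.trans_le hτ1⟩
  -- the slope bound while `b < A₀/2`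
  set m : ℝ := A₀ / 20 + η * k * A₀ * A₀ / 2 with hm
  have hm0 : 0 ≤ m := by positivity
  have hmτ : m * τ ≤ 41 / 80 * A₀ := by
    have e : m * τ = A₀ * (τ / 20 + 1 / 2) := by
      rw [hm]; linear_combination (A₀ / 2) * hxτ
    have h1 := mul_le_mul_of_nonneg_left (show τ / 20 + 1 / 2 ≤ 41 / 80 by linarith) hA.le
    linarith
  -- fence 1: `a ≥ A₀ - m t` on `[0, τ]`
  have hB₁ : ∀ s, HasDerivAt (fun t : ℝ => m * t + -A₀) m s :=
    fun s => (hasDerivAt_const_mul m).add_const _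
  have hA1 : ∀ t ∈ Icc (0:ℝ) τ, A₀ - m * t ≤ (z t).1 := by
    intro t ht
    have key := image_le_of_deriv_right_le_deriv_boundary (f := fun t => -(z t).1)
      hcont'.fst.neg (fun s hs => (hasDerivWithinAt_fst_comp (hderiv' s hs)).neg)
      (B := fun t => m * t + -A₀) (B' := fun _ => m) (by simp [hz0])
      (fun s _ => (hB₁ s).continuousAt.continuousWithinAt)
      (fun s _ => (hB₁ s).hasDerivWithinAt)
      (fun s hs => by
        have hb := basic s (hsub (Ico_subset_Icc_self hs))
        have hbs := (H s (Ico_subset_Icc_self hs)).le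
        rw [hz01] at hb
        show -(pairVF Λ₁ Λ₂ η k 0 (z s)).1 ≤ m
        rw [pairVF_zero_fst]
        have h1 : Λ₁ * (z s).1 ≤ 1 / 20 * A₀ := mul_le_mul hΛ₁' hb.2.1 hb.1.le (by norm_num)
        have h3 : (z s).1 * (z s).2 ≤ A₀ * (A₀ / 2) := mul_le_mul hb.2.1 hbs hb.2.2.1 hA.le
        have h4 := mul_le_mul_of_nonneg_left h3 (mul_nonneg hη0.le hk0.le)
        rw [hm]; nlinarith [h1, h4])
      ht
    have key' : -(z t).1 ≤ m * t + -A₀ := key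
    linarith
  -- fence 2: `-b ≤ α t + β t²` on `[0, τ]`, from `a² ≥ (A₀ - m t)² ≥ A₀² - 2 A₀ m t`
  set α : ℝ := A₀ / 40 - k * A₀ ^ 2 with hα
  set β : ℝ := k * A₀ * m with hβ
  have hB₂ : ∀ s, HasDerivAt (fun t : ℝ => α * t + β * (t * t)) (α + 2 * β * s) s := fun s => by
    have h := (hasDerivAt_const_mul α).fun_add
      (((hasDerivAt_id' s).fun_mul (hasDerivAt_id' s)).const_mul β)
    exact h.congr_deriv (by ring)
  have hB2 : ∀ t ∈ Icc (0:ℝ) τ, -(z t).2 ≤ α * t + β * (t * t) := by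
    intro t ht
    exact image_le_of_deriv_right_le_deriv_boundary (f := fun t => -(z t).2) hcont'.snd.neg
      (fun s hs => (hasDerivWithinAt_snd_comp (hderiv' s hs)).neg)
      (B := fun t => α * t + β * (t * t)) (B' := fun s => α + 2 * β * s) (by simp [hz0])
      (fun s _ => (hB₂ s).continuousAt.continuousWithinAt)
      (fun s _ => (hB₂ s).hasDerivWithinAt)
      (fun s hs => by
        have hb := basic s (hsub (Ico_subset_Icc_self hs))
        have hbs := (H s (Ico_subset_Icc_self hs)).le
        have ha1 := hA1 s (Ico_subset_Icc_self hs)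
        have hms : 0 ≤ A₀ - m * s := by
          have : m * s ≤ m * τ := mul_le_mul_of_nonneg_left hs.2.le hm0
          linarith
        show -(pairVF Λ₁ Λ₂ η k 0 (z s)).2 ≤ α + 2 * β * s
        rw [pairVF_zero_snd]
        have h1 : Λ₂ * (z s).2 ≤ 1 / 20 * (A₀ / 2) := mul_le_mul hΛ₂' hbs hb.2.2.1 (by norm_num)
        have h2 : (A₀ - m * s) ^ 2 ≤ (z s).1 ^ 2 := pow_le_pow_left₀ hms ha1 2
        have h3 := mul_le_mul_of_nonneg_left h2 hk0.le
        rw [hα, hβ]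
        nlinarith [h1, h3, mul_nonneg hk0.le (sq_nonneg (m * s))])
      ht
  -- the value at `τ`: `b(τ) > 0.64 A₀`, contradicting `b(τ) < A₀/2`
  have hQ : 4 / 3 * A₀ ≤ k * A₀ ^ 2 * τ := by
    have e : η * (k * A₀ ^ 2 * τ) = A₀ := by linear_combination A₀ * hxτ
    nlinarith [e, hη2, mul_nonneg hk0.le (mul_nonneg (sq_nonneg A₀) hτpos.le)]
  have key := hB2 τ ⟨hτpos.le, le_rfl⟩
  have h1 : β * (τ * τ) ≤ 41 / 80 * (k * A₀ ^ 2 * τ) := by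
    have h := mul_le_mul_of_nonneg_left hmτ (show 0 ≤ k * A₀ * τ by positivity)
    rw [hβ]; nlinarith [h]
  have h2 : A₀ / 40 * τ ≤ A₀ / 160 := by
    have h := mul_le_mul_of_nonneg_left hτ4 hA.le
    linarith
  have h3 := H τ ⟨hτpos.le, le_rfl⟩
  rw [hα] at key
  nlinarith [key, h1, h2, hQ, h3, hA]

/-- **OUTPUT STAYS UP.** If `b(t_A) ≥ A₀/2` then `b ≥ (A₀/2) e^{-(t - t_A)/10} ≥ 0.45 A₀` on
`[t_A, 1]` (`Λ₂ ≤ 1/20 < 1/10`, the drive `k a²` is nonnegative). [folklore] -/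
theorem pair_snd_ge_after (hΛ₂' : Λ₂ ≤ 1 / 20) (hk : 0 ≤ k) (hcont : ContinuousOn z (Icc 0 1))
    (hderiv : ∀ t ∈ Ico (0:ℝ) 1, HasDerivWithinAt z (pairVF Λ₁ Λ₂ η k 0 (z t)) (Ici t) t)
    {A₀ tA : ℝ} (hA : 0 < A₀) (htA : tA ∈ Icc (0:ℝ) 1) (hbA : A₀ / 2 ≤ (z tA).2) :
    ∀ t ∈ Icc tA 1, 9 / 20 * A₀ ≤ (z t).2 := by
  have hcont' : ContinuousOn z (Icc tA 1) := hcont.mono (Icc_subset_Icc_left htA.1)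
  have hderiv' : ∀ t ∈ Ico tA 1, HasDerivWithinAt z (pairVF Λ₁ Λ₂ η k 0 (z t)) (Ici t) t :=
    fun t ht => hderiv t ⟨htA.1.trans ht.1, ht.2⟩
  set c : ℝ := A₀ / 2 * Real.exp (1 / 10 * tA) with hc
  have hE : ∀ t, c * Real.exp (-(1 / 10) * t) = A₀ / 2 * Real.exp ((tA - t) / 10) := fun t => by
    rw [hc, mul_assoc, ← Real.exp_add]; congr 2; ring
  have hB : ∀ s, HasDerivAt (fun t => -c * Real.exp (-(1 / 10) * t))
      (-c * (Real.exp (-(1 / 10) * s) * -(1 / 10))) s :=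
    fun s => (hasDerivAt_const_mul (-(1 / 10) : ℝ)).exp.const_mul (-c)
  intro t ht
  have key := image_le_of_deriv_right_lt_deriv_boundary (f := fun t => -(z t).2) hcont'.snd.neg
    (fun s hs => (hasDerivWithinAt_snd_comp (hderiv' s hs)).neg)
    (B := fun t => -c * Real.exp (-(1 / 10) * t))
    (B' := fun s => -c * (Real.exp (-(1 / 10) * s) * -(1 / 10)))
    (by
      show -(z tA).2 ≤ -c * Real.exp (-(1 / 10) * tA)
      rw [neg_mul, hE, sub_self, zero_div, Real.exp_zero, mul_one]; linarith) hB
    (fun s _ hfs => by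
      have hfs' : -(z s).2 = -c * Real.exp (-(1 / 10) * s) := hfs
      have hpos : 0 < c * Real.exp (-(1 / 10) * s) := by positivity
      show -(pairVF Λ₁ Λ₂ η k 0 (z s)).2 < -c * (Real.exp (-(1 / 10) * s) * -(1 / 10))
      rw [pairVF_zero_snd]
      have hbs : (z s).2 = c * Real.exp (-(1 / 10) * s) := by linarith
      have h1 := mul_le_mul_of_nonneg_right hΛ₂' hpos.le
      rw [hbs]
      nlinarith [mul_nonneg hk (sq_nonneg (z s).1), hpos, h1])
    ht
  have key' : -(z t).2 ≤ -c * Real.exp (-(1 / 10) * t) := key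
  rw [neg_mul, hE] at key'
  have hexp : 9 / 10 ≤ Real.exp ((tA - t) / 10) := by
    have h2 := Real.add_one_le_exp ((tA - t) / 10)
    have : -1 ≤ tA - t := by linarith [ht.2, htA.1]
    linarith
  nlinarith [key', hexp, hA]

/-- **EXPONENTIAL DECAY OF THE INPUT** on `[t₀, 1]` at any rate `ρ` strictly below `η k b`
there: `a(t) ≤ a(t₀) e^{-ρ (t - t₀)}` (`Λ₁ ≥ 0`, `a > 0`). [folklore] -/
theorem pair_fst_decay (hΛ₁ : 0 ≤ Λ₁) (hcont : ContinuousOn z (Icc 0 1))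
    (hderiv : ∀ t ∈ Ico (0:ℝ) 1, HasDerivWithinAt z (pairVF Λ₁ Λ₂ η k 0 (z t)) (Ici t) t)
    {t₀ ρ : ℝ} (ht₀ : t₀ ∈ Icc (0:ℝ) 1) (hb : ∀ t ∈ Icc t₀ 1, ρ < η * k * (z t).2)
    (ha : ∀ t ∈ Icc t₀ 1, 0 < (z t).1) :
    ∀ t ∈ Icc t₀ 1, (z t).1 ≤ (z t₀).1 * Real.exp (-(ρ * (t - t₀))) := by
  have hcont' : ContinuousOn z (Icc t₀ 1) := hcont.mono (Icc_subset_Icc_left ht₀.1)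
  have hderiv' : ∀ t ∈ Ico t₀ 1, HasDerivWithinAt z (pairVF Λ₁ Λ₂ η k 0 (z t)) (Ici t) t :=
    fun t ht => hderiv t ⟨ht₀.1.trans ht.1, ht.2⟩
  set c : ℝ := (z t₀).1 * Real.exp (ρ * t₀) with hc
  have hE : ∀ t, c * Real.exp (-ρ * t) = (z t₀).1 * Real.exp (-(ρ * (t - t₀))) := fun t => by
    rw [hc, mul_assoc, ← Real.exp_add]; congr 2; ring
  have hB : ∀ s, HasDerivAt (fun t => c * Real.exp (-ρ * t)) (c * (Real.exp (-ρ * s) * -ρ)) s :=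
    fun s => (hasDerivAt_const_mul (-ρ)).exp.const_mul c
  intro t ht
  have key := image_le_of_deriv_right_lt_deriv_boundary (f := fun t => (z t).1) hcont'.fst
    (fun s hs => hasDerivWithinAt_fst_comp (hderiv' s hs))
    (B := fun t => c * Real.exp (-ρ * t)) (B' := fun s => c * (Real.exp (-ρ * s) * -ρ))
    (by show (z t₀).1 ≤ c * Real.exp (-ρ * t₀); rw [hE]; simp) hB
    (fun s hs hfs => by
      have has := ha s (Ico_subset_Icc_self hs)
      have hbs := hb s (Ico_subset_Icc_self hs)
      have hfs' : (z s).1 = c * Real.exp (-ρ * s) := hfs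
      show (pairVF Λ₁ Λ₂ η k 0 (z s)).1 < c * (Real.exp (-ρ * s) * -ρ)
      have e : c * (Real.exp (-ρ * s) * -ρ) = -ρ * (z s).1 := by rw [hfs']; ring
      rw [pairVF_zero_fst, e]
      have h1 : ρ * (z s).1 < η * k * (z s).2 * (z s).1 := mul_lt_mul_of_pos_right hbs has
      nlinarith [h1, mul_nonneg hΛ₁ has.le])
    ht
  have key' : (z t).1 ≤ c * Real.exp (-ρ * t) := key
  rwa [hE] at key'

end Transit

end BlockDesign

end Summit.NavierStokesRegularity.FluidComputer
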